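import Literature.RepresentationTheory.WeightSpacePureTensors
import Mathlib.LinearAlgebra.TensorProduct.Basis
import HarnessLib

/-!
# Weight spaces in a tensor model: coordinates in a basis of the second factor

Topic `RepresentationTheory`; namespace `Literature.RepresentationTheory`.  Continuation of `WeightSpacePureTensors`
(`tmul_mem_weightSpace`: pure tensors of eigenvectors are weight vectors).  Here the CONVERSE: if the operators
`ρ (ι t)` act through the first factor of a tensor model `E : M ⊗ N ≃ V` — `ρ (ι t) (E z) = E ((A t ⊗ id) z)` — and the
second factor `N` is free (e.g. any vector space), then EVERY weight vector is a finite sum of pure tensors `x_i ⊗ c_i`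
with `x_i` in the joint eigenspace of the `A t` and `c_i` running through a basis of `N`:

  `weightSpace ρ ι w = E (jointEigenspace A w ⊗ N)`   (`weightSpace_eq_map_range_rTensor`).

Mechanism (Mathlib `TensorProduct.equivFinsuppOfBasisRight 𝒞 : M ⊗ N ≃ (κ →₀ M)`: "every element of `M ⊗ N` can be
uniquely written as `Σ_i m_i ⊗ 𝒞_i`"): the coordinates of `(f ⊗ id) z` are `f` applied to the coordinates of `z`
(`equivFinsuppOfBasisRight_rTensor`), so an eigen-equation for `f ⊗ id` holds coordinate by coordinate
(`coord_mem_eigenspace_of_rTensor_eq_smul`), and `z ∈ P ⊗ N` iff all coordinates lie in `P`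
(`mem_range_rTensor_subtype_iff`).  Everything is proved from Mathlib; no cited fact.

Use (pub-hodgecm model cell, rows A12/A34, field `dense`): with `V = 𝒮(𝔸)` in the tensor model
`𝒮_∞ ⊗ 𝒮_f ≃ 𝒮(𝔸)` and `K_∞` acting through the archimedean factor, the `κ`-isotypic index space `𝒮^κ` IS
`𝒮_∞^κ ⊗ 𝒮_f`; combined with `SegalBargmann/SchwartzHermiteDegreeComponents` (the archimedean isotypic space is the
closure of its homogeneous members) this reduces `dense` to the algebraic identification of the homogeneous isotypic
Fock polynomials.  Nothing about those objects is asserted here.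

## Mathlib

`TensorProduct.equivFinsuppOfBasisRight` (+ `_apply_tmul`, `_symm_apply`), `LinearMap.rTensor`, `Module.End.eigenspace`,
`Finsupp.mapRange`; tree: `weightSpace`, `mem_weightSpace`.

Provenance: LEAN-IN-TREE rule (2026-08-18), pub-hodgecm model-construction sub-cell, seat mc-binder-2 gen 5; KERNEL only.
[folklore]
-/

noncomputable section

open scoped TensorProduct

namespace Literature.RepresentationTheory

variable {R : Type*} [CommRing R]
variable {M M' N : Type*} [AddCommGroup M] [Module R M] [AddCommGroup M'] [Module R M'] [AddCommGroup N] [Module R N]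
variable {κ : Type*} [DecidableEq κ] (𝒞 : Module.Basis κ R N)

/-! ## 1. Coordinates of `(f ⊗ id) z` -/

/-- **Naturality of the coordinates in the first factor**: the `𝒞`-coordinates of `(f ⊗ id) z` are `f` applied to
the `𝒞`-coordinates of `z`. [folklore] -/
theorem equivFinsuppOfBasisRight_rTensor (f : M →ₗ[R] M') (z : M ⊗[R] N) :
    TensorProduct.equivFinsuppOfBasisRight 𝒞 (f.rTensor N z) =
      (TensorProduct.equivFinsuppOfBasisRight 𝒞 z).mapRange f (map_zero f) := by
  induction z using TensorProduct.induction_on with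
  | zero => simp only [map_zero, Finsupp.mapRange_zero]
  | tmul m n =>
    rw [LinearMap.rTensor_tmul, TensorProduct.equivFinsuppOfBasisRight_apply_tmul,
      TensorProduct.equivFinsuppOfBasisRight_apply_tmul]
    ext i
    simp only [Finsupp.mapRange_apply, map_smul]
  | add z₁ z₂ h₁ h₂ =>
    rw [map_add, map_add, h₁, h₂, map_add, Finsupp.mapRange_add (map_add f)]

/-- Coordinate form. [folklore] -/
theorem equivFinsuppOfBasisRight_rTensor_apply (f : M →ₗ[R] M') (z : M ⊗[R] N) (i : κ) :
    TensorProduct.equivFinsuppOfBasisRight 𝒞 (f.rTensor N z) i =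
      f (TensorProduct.equivFinsuppOfBasisRight 𝒞 z i) := by
  rw [equivFinsuppOfBasisRight_rTensor, Finsupp.mapRange_apply]

/-- **An eigen-equation for `f ⊗ id` holds coordinate by coordinate.** [folklore] -/
theorem coord_mem_eigenspace_of_rTensor_eq_smul (f : Module.End R M) (c : R) {z : M ⊗[R] N}
    (hz : f.rTensor N z = c • z) (i : κ) :
    TensorProduct.equivFinsuppOfBasisRight 𝒞 z i ∈ Module.End.eigenspace f c := by
  rw [Module.End.mem_eigenspace_iff, ← equivFinsuppOfBasisRight_rTensor_apply, hz, map_smul, Finsupp.smul_apply]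

/-! ## 2. `z ∈ P ⊗ N` iff all coordinates lie in `P` -/

/-- A finitely supported family with values in a submodule `P`, as a family in `P`. [folklore] -/
def finsuppCodRestrict (P : Submodule R M) (c : κ →₀ M) (hc : ∀ i, c i ∈ P) : κ →₀ P where
  support := c.support
  toFun i := ⟨c i, hc i⟩
  mem_support_toFun i := by
    rw [Finsupp.mem_support_iff, ne_eq, ne_eq, ← Subtype.coe_inj, Submodule.coe_zero]

omit [DecidableEq κ] in
/-- Values. [folklore] -/
@[simp] theorem finsuppCodRestrict_apply (P : Submodule R M) (c : κ →₀ M) (hc : ∀ i, c i ∈ P) (i : κ) :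
    (finsuppCodRestrict P c hc i : M) = c i := rfl

omit [DecidableEq κ] in
/-- Forgetting the restriction recovers the family. [folklore] -/
theorem mapRange_subtype_finsuppCodRestrict (P : Submodule R M) (c : κ →₀ M) (hc : ∀ i, c i ∈ P) :
    (finsuppCodRestrict P c hc).mapRange P.subtype (map_zero _) = c := by
  ext i; rfl

/-- **`z ∈ P ⊗ N` (the range of `P.subtype ⊗ id`) iff every `𝒞`-coordinate of `z` lies in `P`.** [folklore] -/
theorem mem_range_rTensor_subtype_iff (P : Submodule R M) (z : M ⊗[R] N) :
    z ∈ LinearMap.range (P.subtype.rTensor N) ↔ ∀ i, TensorProduct.equivFinsuppOfBasisRight 𝒞 z i ∈ P := by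
  constructor
  · rintro ⟨y, rfl⟩ i
    rw [equivFinsuppOfBasisRight_rTensor_apply]
    exact Submodule.coe_mem _
  · intro h
    refine ⟨(TensorProduct.equivFinsuppOfBasisRight 𝒞).symm
      (finsuppCodRestrict P (TensorProduct.equivFinsuppOfBasisRight 𝒞 z) h), ?_⟩
    apply (TensorProduct.equivFinsuppOfBasisRight 𝒞).injective
    rw [equivFinsuppOfBasisRight_rTensor, LinearEquiv.apply_symm_apply, mapRange_subtype_finsuppCodRestrict]

/-! ## 3. Eigenvectors of `f ⊗ id` -/

/-- **Eigenvectors of `f ⊗ id` lie in `(eigenspace of f) ⊗ N`** (`N` free, e.g. any vector space). [folklore] -/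
theorem mem_range_rTensor_eigenspace_of_eq_smul [Module.Free R N] (f : Module.End R M) (c : R) {z : M ⊗[R] N}
    (hz : f.rTensor N z = c • z) :
    z ∈ LinearMap.range ((Module.End.eigenspace f c).subtype.rTensor N) := by
  classical
  let 𝒞 := Module.Free.chooseBasis R N
  exact (mem_range_rTensor_subtype_iff 𝒞 _ z).mpr fun i => coord_mem_eigenspace_of_rTensor_eq_smul 𝒞 f c hz i

/-- **The joint eigenspace of a family of endomorphisms** `A t` with eigenvalues `w t`. [folklore] -/
def jointEigenspace {T : Type*} (A : T → Module.End R M) (w : T → R) : Submodule R M :=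
  ⨅ t, Module.End.eigenspace (A t) (w t)

omit [DecidableEq κ] in
/-- Membership. [folklore] -/
theorem mem_jointEigenspace {T : Type*} {A : T → Module.End R M} {w : T → R} {x : M} :
    x ∈ jointEigenspace A w ↔ ∀ t, A t x = w t • x := by
  simp only [jointEigenspace, Submodule.mem_iInf, Module.End.mem_eigenspace_iff]

/-- **Joint eigenvectors of a family `A t ⊗ id` lie in `(joint eigenspace) ⊗ N`** (`N` free). [folklore] -/
theorem mem_range_rTensor_jointEigenspace_of_forall_eq_smul [Module.Free R N] {T : Type*} (A : T → Module.End R M)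
    (w : T → R) {z : M ⊗[R] N} (hz : ∀ t, (A t).rTensor N z = w t • z) :
    z ∈ LinearMap.range ((jointEigenspace A w).subtype.rTensor N) := by
  classical
  let 𝒞 := Module.Free.chooseBasis R N
  exact (mem_range_rTensor_subtype_iff 𝒞 _ z).mpr fun i =>
    mem_jointEigenspace.mpr fun t =>
      Module.End.mem_eigenspace_iff.mp (coord_mem_eigenspace_of_rTensor_eq_smul 𝒞 (A t) (w t) (hz t) i)

/-- Conversely the range consists of joint eigenvectors. [folklore] -/
theorem forall_rTensor_eq_smul_of_mem_range {T : Type*} (A : T → Module.End R M) (w : T → R) {z : M ⊗[R] N}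
    (hz : z ∈ LinearMap.range ((jointEigenspace A w).subtype.rTensor N)) (t : T) :
    (A t).rTensor N z = w t • z := by
  obtain ⟨y, rfl⟩ := hz
  rw [← LinearMap.comp_apply, ← LinearMap.rTensor_comp]
  have h : A t ∘ₗ (jointEigenspace A w).subtype = w t • (jointEigenspace A w).subtype := by
    ext x
    exact mem_jointEigenspace.mp x.2 t
  rw [h, LinearMap.rTensor_smul, LinearMap.smul_apply]

/-! ## 4. Weight spaces of a representation acting through the first factor of a tensor model -/

variable {G : Type*} [Monoid G] {V : Type*} [AddCommGroup V] [Module R V]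
variable {ρ : Representation R G V} {T : Type*} {ι : T → G} {w : T → R}

/-- **Weight spaces in a tensor model with free second factor.**  If every `ρ (ι t)` acts through the first factor,
`ρ (ι t) (E z) = E ((A t ⊗ id) z)`, then the weight space of weight `w` is exactly the image under `E` of
`(jointEigenspace A w) ⊗ N`: every weight vector is a finite sum `Σ_i E (x_i ⊗ 𝒞_i)` with joint eigenvectors `x_i`.
[folklore] -/
theorem weightSpace_eq_map_range_rTensor [Module.Free R N] (E : M ⊗[R] N ≃ₗ[R] V) (A : T → Module.End R M)
    (hρ : ∀ (t : T) (z : M ⊗[R] N), ρ (ι t) (E z) = E ((A t).rTensor N z)) :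
    weightSpace ρ ι w = (LinearMap.range ((jointEigenspace A w).subtype.rTensor N)).map (E : M ⊗[R] N →ₗ[R] V) := by
  ext v
  rw [mem_weightSpace, Submodule.mem_map]
  constructor
  · intro hv
    refine ⟨E.symm v, mem_range_rTensor_jointEigenspace_of_forall_eq_smul A w fun t => ?_, E.apply_symm_apply v⟩
    apply E.injective
    rw [← hρ, E.apply_symm_apply, map_smul, E.apply_symm_apply, hv t]
  · rintro ⟨z, hz, rfl⟩ t
    rw [LinearEquiv.coe_coe, hρ, forall_rTensor_eq_smul_of_mem_range A w hz t, map_smul]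

/-- Membership form: a weight vector is `E` of a finite sum of pure tensors `x ⊗ 𝒞_i` with `x` a joint
eigenvector — the `𝒞`-coordinates of `E⁻¹ v`. [folklore] -/
theorem eq_sum_tmul_of_mem_weightSpace (E : M ⊗[R] N ≃ₗ[R] V) (A : T → Module.End R M)
    (hρ : ∀ (t : T) (z : M ⊗[R] N), ρ (ι t) (E z) = E ((A t).rTensor N z)) {v : V}
    (hv : v ∈ weightSpace ρ ι w) :
    (∀ i, TensorProduct.equivFinsuppOfBasisRight 𝒞 (E.symm v) i ∈ jointEigenspace A w) ∧
      v = (TensorProduct.equivFinsuppOfBasisRight 𝒞 (E.symm v)).sum fun i x => E (x ⊗ₜ 𝒞 i) := by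
  haveI : Module.Free R N := Module.Free.of_basis 𝒞
  have hz : E.symm v ∈ LinearMap.range ((jointEigenspace A w).subtype.rTensor N) := by
    rw [weightSpace_eq_map_range_rTensor E A hρ, Submodule.mem_map] at hv
    obtain ⟨z, hz, rfl⟩ := hv
    rwa [LinearEquiv.coe_coe, E.symm_apply_apply]
  refine ⟨(mem_range_rTensor_subtype_iff 𝒞 _ _).mp hz, ?_⟩
  conv_lhs => rw [← E.apply_symm_apply v,
    ← (TensorProduct.equivFinsuppOfBasisRight 𝒞).symm_apply_apply (E.symm v),
    TensorProduct.equivFinsuppOfBasisRight_symm_apply, map_finsuppSum]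

end Literature.RepresentationTheory

end
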